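import Mathlib
import Literature.Topology.FourManifolds.OpenCone

/-!
# Continuous slow rulers (pure Mathlib) — negative-side support for crux `LatticeGapInUVUnitsC`

Support file for crux `stmt-QuantumFields-16206` =
`Summit.QuantumFields.YangMills.Theses.LangevinControlUV.LatticeGapInUVUnitsC` (route `LangevinControlUV`, rank 5),
the repair C′ (`Continuous a`) of `LatticeGapInUVUnits` (stmt-9366). No gauge theory is imported: this is the order
bookkeeping behind `Negative/LowerBoundLoadBearing.lean`, the continuous counterpart of the parent's
`Negative/SlowRulers.lean` (generic STEP rulers).

* `stair t = ∑ᶠ n, ramp (· − t n)` (the tree's clamp `OpenCone.ramp`) — a locally finite sum of unit ramps started at the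
  thresholds `t n`
  (`t` monotone, `t n ≥ n`): continuous (`continuous_stair`, via `continuous_finsum`), monotone, `stair ≤ N` before
  `t N` (`stair_le`) and `≥ N + 1` after `t N + 1` (`le_stair`).
* `exists_continuous_slow_ruler` — above ANY obstacle (thresholds `T L` per box side, bad couplings `S j`) there is a
  CONTINUOUS antitone unit map `0 < a ≤ 1`, `a → 0`, whose femto boxes `L a(β) ≤ 1`, `L ≥ 2`, occur only at
  `β > T L`, with `a (S j) ≥ 1/(j+1)`: `a = 1/(1 + stair t)` for the running maximum `t` of `max (T (i+2)) (S i) i`.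

Moral for the crux: continuity of the unit map is NO obstruction to arbitrarily slow decay; what it buys in
`LatticeGapInUVUnitsC` comes only in combination with the package's LOWER bound (see the companion file).
-/

namespace Summit.QuantumFields.YangMills.Theorems.LatticeGapInUVUnitsC.Negative

open Filter Topology
open Literature.Topology.FourManifolds.OpenCone (ramp ramp_nonneg ramp_le_one ramp_of_le_zero ramp_of_one_le ramp_mono
  continuous_ramp)

noncomputable section

/-! ## The staircase of a threshold sequence -/

/-! The staircase `∑ᶠ n, ramp (β - t n)` of a threshold sequence `t : ℕ → ℝ` (the `n`-th unit step is climbed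
linearly on `[t n, t n + 1]`) is kept as an expression — no definition is introduced. -/

variable {t : ℕ → ℝ}

/-- Beyond index `N` with `β ≤ t N` no step has started (monotone thresholds). [folklore] -/
theorem support_ramp_subset_range (ht : Monotone t) {β : ℝ} {N : ℕ} (hN : β ≤ t N) :
    (Function.support fun n => ramp (β - t n)) ⊆ ((Finset.range N : Finset ℕ) : Set ℕ) := by
  intro n hn
  rw [Function.mem_support] at hn
  rw [Finset.coe_range, Set.mem_Iio]
  by_contra h
  push Not at h
  exact hn (ramp_of_le_zero (by linarith [ht h]))

/-- The staircase is a finite sum over the steps that may have started. [folklore] -/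
theorem stair_eq_sum (ht : Monotone t) {β : ℝ} {N : ℕ} (hN : β ≤ t N) :
    ∑ᶠ n, ramp (β - t n) = ∑ n ∈ Finset.range N, ramp (β - t n) :=
  finsum_eq_sum_of_support_subset _ (support_ramp_subset_range ht hN)

/-- `∑ᶠ n, ramp (β - t n) ≤ N` as long as the `N`-th step has not started. [folklore] -/
theorem stair_le (ht : Monotone t) {β : ℝ} {N : ℕ} (hN : β ≤ t N) : ∑ᶠ n, ramp (β - t n) ≤ N := by
  rw [stair_eq_sum ht hN]
  calc ∑ n ∈ Finset.range N, ramp (β - t n) ≤ ∑ _n ∈ Finset.range N, (1 : ℝ) :=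
        Finset.sum_le_sum fun n _ => ramp_le_one _
    _ = N := by simp

/-- `N + 1 ≤ ∑ᶠ n, ramp (β - t n)` once the `N`-th step is complete (thresholds monotone and `t n ≥ n`). [folklore] -/
theorem le_stair (ht : Monotone t) (hgrow : ∀ n : ℕ, (n : ℝ) ≤ t n) {β : ℝ} {N : ℕ} (hN : t N + 1 ≤ β) :
    (N : ℝ) + 1 ≤ ∑ᶠ n, ramp (β - t n) := by
  have hM : β ≤ t ⌈β⌉₊ := (Nat.le_ceil β).trans (hgrow _)
  rw [stair_eq_sum ht hM]
  have hN1 : N + 1 ≤ ⌈β⌉₊ := by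
    have h1 : ((N + 1 : ℕ) : ℝ) ≤ β := by push_cast; linarith [hgrow N]
    exact_mod_cast h1.trans (Nat.le_ceil β)
  calc (N : ℝ) + 1 = ∑ _n ∈ Finset.range (N + 1), (1 : ℝ) := by simp
    _ = ∑ n ∈ Finset.range (N + 1), ramp (β - t n) := by
        refine Finset.sum_congr rfl fun n hn => ?_
        rw [Finset.mem_range, Nat.lt_succ_iff] at hn
        rw [ramp_of_one_le]
        linarith [ht hn]
    _ ≤ ∑ n ∈ Finset.range ⌈β⌉₊, ramp (β - t n) :=
        Finset.sum_le_sum_of_subset_of_nonneg (Finset.range_subset_range.2 hN1) fun n _ _ => ramp_nonneg _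

/-- The staircase is non-negative. [folklore] -/
theorem stair_nonneg (β : ℝ) : 0 ≤ ∑ᶠ n, ramp (β - t n) := finsum_nonneg fun _ => ramp_nonneg _

/-- The staircase is monotone. [folklore] -/
theorem stair_mono (ht : Monotone t) (hgrow : ∀ n : ℕ, (n : ℝ) ≤ t n) : Monotone fun β => ∑ᶠ n, ramp (β - t n) := by
  intro β β' hle
  have hM' : β' ≤ t ⌈β'⌉₊ := (Nat.le_ceil β').trans (hgrow _)
  show ∑ᶠ n, ramp (β - t n) ≤ ∑ᶠ n, ramp (β' - t n)
  rw [stair_eq_sum ht (hle.trans hM'), stair_eq_sum ht hM']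
  exact Finset.sum_le_sum fun n _ => ramp_mono (by linarith)

/-- The staircase is continuous (a locally finite sum of continuous ramps, `t n ≥ n`). [folklore] -/
theorem continuous_stair (hgrow : ∀ n : ℕ, (n : ℝ) ≤ t n) : Continuous fun β => ∑ᶠ n, ramp (β - t n) := by
  refine continuous_finsum (fun n => continuous_ramp.comp (continuous_id.sub continuous_const)) ?_
  intro x
  refine ⟨Set.Iio (x + 1), Iio_mem_nhds (by linarith), ?_⟩
  refine (Finset.range (⌈x⌉₊ + 1)).finite_toSet.subset fun n hn => ?_
  obtain ⟨β, hβ, hβx⟩ := hn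
  rw [Function.mem_support] at hβ
  rw [Set.mem_Iio] at hβx
  rw [Finset.coe_range, Set.mem_Iio]
  have htn : t n < β := by
    by_contra h
    push Not at h
    exact hβ (ramp_of_le_zero (by linarith))
  have h1 : (n : ℝ) < x + 1 := (hgrow n).trans_lt (htn.trans hβx)
  have h2 : (n : ℝ) < (⌈x⌉₊ : ℝ) + 1 := by linarith [Nat.le_ceil x]
  exact_mod_cast h2

/-! ## Continuous slow rulers -/

/-- **Continuous (and antitone) slow rulers above any obstacle.** For every sequence of thresholds `T : ℕ → ℝ`
(think: the torus of side `L` is "tame" at all couplings `β > T L`) and every sequence of couplings `S : ℕ → ℝ`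
(think: couplings at which something bad happens) there is a CONTINUOUS, antitone unit map `a : ℝ → ℝ` with
`0 < a ≤ 1`, `a → 0` at `+∞`, such that
* every box `L ≥ 2` that is femto for `a` at `β` (`L · a β ≤ 1`) is tame (`T L < β`), and
* `a` is still large at the bad couplings: `a (S j) ≥ 1/(j+1)`.
Construction: `a = 1/(1 + stair t)` for the running maximum `t` of `max (T (i+2)) (S i) i`. So continuity is NO
obstruction to arbitrarily slow decay: what continuity buys in the repaired crux `LatticeGapInUVUnitsC` comes only in
combination with the package's LOWER bound. [folklore] -/
theorem exists_continuous_slow_ruler (T : ℕ → ℝ) (S : ℕ → ℝ) :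
    ∃ a : ℝ → ℝ, Continuous a ∧ Antitone a ∧ (∀ β, 0 < a β) ∧ (∀ β, a β ≤ 1) ∧
      Tendsto a atTop (𝓝 0) ∧
      (∀ (β : ℝ) (L : ℕ), 2 ≤ L → (L : ℝ) * a β ≤ 1 → T L < β) ∧
      ∀ j : ℕ, 1 / ((j : ℝ) + 1) ≤ a (S j) := by
  let f : ℕ → ℝ := fun i => max (max (T (i + 2)) (S i)) (i : ℝ)
  let t : ℕ → ℝ := fun i => partialSups f i
  have ht : Monotone t := fun i j h => (partialSups f).monotone h
  have hft : ∀ i, f i ≤ t i := fun i => le_partialSups f i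
  have hgrow : ∀ n : ℕ, (n : ℝ) ≤ t n := fun n => (le_max_right _ _).trans (hft n)
  have hT : ∀ i, T (i + 2) ≤ t i := fun i => ((le_max_left _ _).trans (le_max_left _ _)).trans (hft i)
  have hS : ∀ i, S i ≤ t i := fun i => ((le_max_right _ _).trans (le_max_left _ _)).trans (hft i)
  have hpos : ∀ β, 0 < 1 + ∑ᶠ n, ramp (β - t n) := fun β => by linarith [stair_nonneg (t := t) β]
  refine ⟨fun β => 1 / (1 + ∑ᶠ n, ramp (β - t n)), ?_, ?_, fun β => by positivity [hpos β], fun β => ?_, ?_, ?_, ?_⟩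
  · exact continuous_const.div (continuous_const.add (continuous_stair hgrow)) fun β => (hpos β).ne'
  · exact fun β β' hle => one_div_le_one_div_of_le (hpos β) (by linarith [stair_mono ht hgrow hle])
  · rw [div_le_one (hpos β)]
    linarith [stair_nonneg (t := t) β]
  · refine Metric.tendsto_atTop.2 fun ε hε => ?_
    obtain ⟨N, hN⟩ := exists_nat_one_div_lt hε
    refine ⟨t N + 1, fun β hβ => ?_⟩
    rw [Real.dist_eq, sub_zero, abs_of_pos (by positivity [hpos β])]
    have h1 : (N : ℝ) + 1 ≤ ∑ᶠ n, ramp (β - t n) := le_stair ht hgrow hβ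
    calc 1 / (1 + ∑ᶠ n, ramp (β - t n)) ≤ 1 / ((N : ℝ) + 1) :=
          one_div_le_one_div_of_le (by positivity) (by linarith)
      _ < ε := hN
  · intro β L hL hbox
    rw [mul_one_div, div_le_one (hpos β)] at hbox
    by_contra hcon
    push Not at hcon
    obtain ⟨m, rfl⟩ : ∃ m, L = m + 2 := ⟨L - 2, by omega⟩
    have h1 : ∑ᶠ n, ramp (β - t n) ≤ m := stair_le ht (hcon.trans (hT m))
    push_cast at hbox
    linarith
  · intro j
    have h1 : ∑ᶠ n, ramp (S j - t n) ≤ j := stair_le ht (hS j)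
    exact one_div_le_one_div_of_le (hpos _) (by linarith)

end

end Summit.QuantumFields.YangMills.Theorems.LatticeGapInUVUnitsC.Negative
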